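import Summits.Ventures.PercRepro.HallDisjointPairs

/-!
# PercRepro — HALL'S CONDITION FOR DISJOINTNESS ON ALL THE PAIRS OF A SET (the Kneser case)
(p10, gen 4; `proofs/P10-HALLROW.md` §5, the nullity-0 / all-pairs configurations of the base lemma (KL))

For the family of ALL 2-subsets of a set `E` with `≥ 4` elements, the disjointness relation is regular: every pair
is disjoint from exactly `C(|E|−2, 2)` pairs.  Double counting the disjoint pairs `(B, C)` with `B ∈ 𝒜` gives
`#𝒜 · C(|E|−2, 2) ≤ #nbr(𝒜) · C(|E|−2, 2)`, i.e. Hall's condition — for every `|E| ≥ 4`, in particular in the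
cases (`|E| = 5`, free matroid) where the hypotheses of `hall_disjoint_pairs` fail.

* `disjointPairs` — the pairs `(B, C)` with `B ∈ 𝒜` and `C` a pair of `E ∖ B`;
* `card_disjointPairs` — `#𝒜 · C(|E|−2, 2)`;
* `card_disjointPairs_le` — at most `#nbr(𝒜) · C(|E|−2, 2)` (the swap `(B, C) ↦ (C, B)`);
* **`hall_disjoint_all_pairs`** — Hall's condition for disjointness on `E.powersetCard 2`.
-/

namespace PercRepro.HallDisjoint

open Finset

variable {α : Type} [DecidableEq α]

/-- The pairs `(B, C)` with `B ∈ 𝒜` and `C` a 2-subset of `E ∖ B`. -/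
noncomputable def disjointPairs (E : Finset α) (𝒜 : Finset (Finset α)) : Finset (Σ _ : Finset α, Finset α) :=
  𝒜.sigma (fun B => (E \ B).powersetCard 2)

/-- `#disjointPairs = #𝒜 · C(|E| − 2, 2)` for a family of 2-subsets of `E`. -/
theorem card_disjointPairs (E : Finset α) {𝒜 : Finset (Finset α)} (h𝒜 : 𝒜 ⊆ E.powersetCard 2) :
    (disjointPairs E 𝒜).card = 𝒜.card * (E.card - 2).choose 2 := by
  unfold disjointPairs
  rw [card_sigma]
  rw [sum_congr rfl (fun B hB => ?_), sum_const, smul_eq_mul]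
  rw [card_powersetCard]
  have hB' := mem_powersetCard.1 (h𝒜 hB)
  rw [card_sdiff_of_subset hB'.1, hB'.2]

/-- `(B, C) ↦ (C, B)` injects `disjointPairs E 𝒜` into the pairs `(C, B)` with `C ∈ nbr` and `B` a pair of
`E ∖ C`; hence `#disjointPairs ≤ #nbr · C(|E| − 2, 2)`. -/
theorem card_disjointPairs_le (E : Finset α) {𝒜 : Finset (Finset α)} (h𝒜 : 𝒜 ⊆ E.powersetCard 2) :
    (disjointPairs E 𝒜).card ≤ (nbr (E.powersetCard 2) 𝒜).card * (E.card - 2).choose 2 := by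
  have hN : nbr (E.powersetCard 2) 𝒜 ⊆ E.powersetCard 2 := filter_subset _ _
  have htarget : ((nbr (E.powersetCard 2) 𝒜).sigma (fun C => (E \ C).powersetCard 2)).card =
      (nbr (E.powersetCard 2) 𝒜).card * (E.card - 2).choose 2 := by
    rw [card_sigma, sum_congr rfl (fun C hC => ?_), sum_const, smul_eq_mul]
    rw [card_powersetCard]
    have hC' := mem_powersetCard.1 (hN hC)
    rw [card_sdiff_of_subset hC'.1, hC'.2]
  rw [← htarget]
  apply card_le_card_of_injOn (fun p : Σ _ : Finset α, Finset α => (⟨p.2, p.1⟩ : Σ _ : Finset α, Finset α))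
  · intro p hp
    rw [Finset.mem_coe] at hp
    unfold disjointPairs at hp
    rw [mem_sigma] at hp
    obtain ⟨hB, hC⟩ := hp
    have hB' := mem_powersetCard.1 (h𝒜 hB)
    have hC' := mem_powersetCard.1 hC
    have hdisj : Disjoint p.1 p.2 := disjoint_of_subset_right hC'.1 sdiff_disjoint.symm
    rw [Finset.mem_coe, mem_sigma]
    constructor
    · unfold nbr
      rw [mem_filter, mem_powersetCard]
      exact ⟨⟨hC'.1.trans sdiff_subset, hC'.2⟩, p.1, hB, hdisj⟩
    · rw [mem_powersetCard]
      refine ⟨?_, hB'.2⟩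
      intro x hx
      rw [mem_sdiff]
      exact ⟨hB'.1 hx, fun hxC => disjoint_left.1 hdisj hx hxC⟩
  · intro p _ p' _ h
    simp only [Sigma.mk.injEq] at h
    obtain ⟨h1, h2⟩ := h
    exact Sigma.ext (eq_of_heq h2) (heq_of_eq h1)

/-- **Hall's condition for disjointness on all the pairs of a set with at least four elements.** -/
theorem hall_disjoint_all_pairs (E : Finset α) (hE : 4 ≤ E.card) {𝒜 : Finset (Finset α)}
    (h𝒜 : 𝒜 ⊆ E.powersetCard 2) : 𝒜.card ≤ (nbr (E.powersetCard 2) 𝒜).card := by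
  have h1 := card_disjointPairs E h𝒜
  have h2 := card_disjointPairs_le E h𝒜
  have hpos : 0 < (E.card - 2).choose 2 := Nat.choose_pos (by omega)
  rw [h1] at h2
  exact Nat.le_of_mul_le_mul_right h2 hpos

end PercRepro.HallDisjoint
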